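import Literature.Barriers.Parity.FordMaynardPrimeSieves
import HarnessLib

/-!
# Ford–Maynard, Theorem 2.7 (b): primes from Type-I level `x^{1/2}` and a Type-II window of width `≥ 0.1663`

Statement layer (one NAMED FACT, `FordMaynard2024_thm27b`, plus definitions and proved corollaries)
for Theorem 2.7 (b) of K. Ford, J. Maynard, *On the theory of prime producing sieves*
(arXiv:2407.14368, 2024), the positive half of their analysis of the parameter family
`P = (γ, θ, ν) = (1/2, 0, ν)`, `0 ≤ ν < 1/3` (§2.4, "the second parameter family", prominent in
Duke–Friedlander–Iwaniec and Sarnak–Ubis):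

  **Theorem 2.7.** Fix `ϱ ≥ 1`. (b) For `ν ≥ 0.1663`, `C⁻(1/2, 0, ν) > 0` and
  `lim_{ε → 0⁺} ℬ⁻(1/2 − ε, ε, ν − 2ε; ϱ) > 0`.

Here `C⁻(γ, θ, ν)` (Definition 4.8) is the supremum of the constants `C` such that for every
`ϖ > 1` there is `B > 0` with `∑_p a_p ≥ C ∑_p b_p` for all large `x` and all pairs
`((a_n), (b_n)) ∈ Ψ(γ, θ, ν; B, ϖ, x)` (Definition 4.7: non-negative sequences on `(x/2, x]`, `b`
satisfying (b.1)–(b.2), `w = a − b` satisfying the Type-I bound (I) at level `x^γ`, the Type-II bound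
(II) on `((x/2)^θ, x^{θ+ν}]` and the growth condition (w)); `ℬ⁻(γ, θ, ν; ϱ)` (Definition 4.9) is the
same supremum over the pairs satisfying in addition
`|w_n| ≤ τ(n)^ϱ (x/2 < n ≤ x)` and `∑_p b_p ≥ x/(ϱ log x)` (4.3) — the DIVISOR-BOUNDED class, for
which `ν ↦ lim_{ε→0⁺} ℬ⁻(1/2 − ε, ε, ν − 2ε; ϱ)` becomes positive somewhere in `[0.1616, 0.1663]`
(Theorem 2.7 (b), (c)), answering a question of Duke–Friedlander–Iwaniec [§2.4].

## Transcription (comparison sequence `b_n = 1`)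

As for Theorems 2.1 and 4.16 (`Literature.Barriers.Parity.FordMaynardMinimalTypeII`,
`…FordMaynardLowLevel`), the statement is vendored for the comparison sequence `b_n = 1` on `(x/2, x]`,
which satisfies (b.1) and (b.2) for every `ϖ, B > 1` and large `x` [Lemma 4.6 with `q = 1`,
`y = x/2`] and `∑_{x/2 < p ≤ x} 1 ≥ x/(ϱ' log x)` for `ϱ' ≥ 3` and large `x` (prime number theorem);
the Type-I/II bounds are the tree's `FordMaynard.TypeI` / `FordMaynard.TypeII`
(`Literature/Barriers/Parity/FordMaynardPrimeSieves.lean`). For `a ≥ 0` and `w = a − 1` the second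
half `w_n ≥ −x^{ν/10}` of (w) is automatic (`x ≥ 1`), and under (4.3) the first half
`∑ |w_n| τ(n) ≤ x (log x)^ϖ` holds as soon as `ϖ` is large in terms of `ϱ` ("this extra hypothesis
automatically implies (w) if `ϖ` is large enough in terms of `ϱ`", §2.3); larger `B` only shrinks
`Ψ` (for `x ≥ e`). Unfolding Definitions 4.8/4.9 with these remarks (and `ϱ' = max(ϱ, 3)` in (4.3),
which only enlarges the class since `τ(n)^ϱ ≤ τ(n)^{ϱ'}`), Theorem 2.7 (b) yields exactly the two
clauses of `FordMaynard2024_thm27b` below: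

* `IsLowerSieveConst γ θ ν c` — "`c` is admissible in Definition 4.8 for the pairs `(a, 1)`";
* `IsLowerSieveConstBdd γ θ ν ϱ c` — "`c` is admissible in Definition 4.9 for the pairs `(a, 1)` with
  `|a_n − 1| ≤ τ(n)^ϱ`", with (w) and `ϖ` eliminated as just explained;
* `lim_{ε→0⁺} ℬ⁻(P_ε; ϱ) > 0` is read literally: some `c > 0` is admissible at `P_ε` for all
  sufficiently small `ε > 0` (the function `ε ↦ ℬ⁻(P_ε; ϱ)` is monotone, Proposition 4.10).

The fact is stated for `0.1663 ≤ ν < 1/3`, the range of the family in §2.4; the PROVED corollaries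
`FordMaynard2024_thm27b.lowerSieveConst` / `.lowerSieveConstBdd` extend it to `0.1663 ≤ ν ≤ 1` and to
every real `ϱ` by the monotonicity of the hypotheses (Proposition 4.10: a wider Type-II window and a
smaller `ϱ` only shrink the class of sequences — `TypeII.mono_width`, `DivisorBounded.mono`).

-- TODO(general form): general comparison sequences `(b_n)` under (b.1)–(b.2) (Definition 4.7) require
-- the coagulation sets `𝒞(ℛ(P))` and integrals over convex subsets of hyperplanes; not needed by the
-- current dependents (route `Parity/ParityLeakOneFifth`, host `a_n = 1 − λ(n+2)`, `b_n = 1`).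

## Caveat on the printed proof (recorded, not editorialised)

The proof of (b) [§8, pp. 47–48] takes `ν = 0.16623`, exhibits a sieve function `g` on `𝒢₁(P)` with
`(1 ⋆ g)(𝐱) ≤ 0` on `ℋ(P)`, and obtains from Theorem 7.3 (a) ("Sieve bounds") and Theorem 8.3 that
`C⁻(P) ≥ C` and `ℬ⁻(P_ε; ϱ) ≥ C − O(ε)` with `C = 1 + I₃ + I₄ + I₅ + I₅' + I₆`, where
`|I₅'| < 3·10⁻⁷`, `|I₆| < 10⁻¹²` are bounded by hand and `I₃ = −0.92205199…`, `I₄ = −0.07714894…`,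
`I₅ = −0.00079222…` "were computed with Mathematica", giving `C ≥ 0.000006`: the positivity margin is
`6·10⁻⁶` and rests on that numerical evaluation of three multiple integrals (no interval-arithmetic
certificate is printed). The threshold `0.1663` of the statement is the rounding of `0.16623`.

## References

* K. Ford, J. Maynard, *On the theory of prime producing sieves*, arXiv:2407.14368v1 (2024): §1 (I),
  (II); §2 (w); §2.3 (definition of `ℬ^±`, remark on (w)); §2.4 Theorem 2.7 and the discussion
  following it (Duke–Friedlander–Iwaniec, Sarnak–Ubis); §4.2 (b.1), (b.2), Lemma 4.6; §4.3
  Definitions 4.7–4.9, (4.3), Proposition 4.10 and the Remark; §7 Theorem 7.3; §8.2 Theorems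
  8.2–8.3, Lemma 8.4 and the proof of Theorem 2.7 (b) (pp. 47–48). (`lit read arxiv:2407.14368`, pages 3, 5, 7, 8, 12, 13,
  46–48.) [FordMaynard2024PrimeSieves]
* W. Duke, J. B. Friedlander, H. Iwaniec, *Equidistribution of roots of a quadratic congruence to
  prime moduli*, Ann. of Math. (2) 141 (1995), 423–441 (the case `ν = 1/5`: `ℬ⁻ ≥ 0.23` at `ϱ = 1`
  for small `ε`), and P. Sarnak, A. Ubis, *The horocycle flow at prime times*, J. Math. Pures Appl.
  (9) 103 (2015), 575–618 — both as reported in [FordMaynard2024PrimeSieves, §2.4 and references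
  [DFI], [SU]]; not read here.
-/

noncomputable section

open Finset
open Literature.Barriers.Parity

namespace Literature.NumberTheory.Sieve.FordMaynard

/-! ### The dyadic window and the hypothesis classes (comparison sequence `b_n = 1`) -/

/-- The primes of the dyadic window `(x/2, x]` (the support of all sequences in Ford–Maynard's
setup, §2: "supported on integers in `(x/2, x]`"); `∑_p b_p` for `b = 1` is its cardinality.
[cite: FordMaynard2024PrimeSieves, §2 (first paragraph)] -/
def windowPrimes (x : ℝ) : Finset ℕ :=
  (Nat.primesLE ⌊x⌋₊).filter (fun p : ℕ => x / 2 < (p : ℝ))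

/-- Membership in `windowPrimes x`: `p` prime with `x/2 < p ≤ x`. [folklore] -/
theorem mem_windowPrimes {x : ℝ} {p : ℕ} :
    p ∈ windowPrimes x ↔ p.Prime ∧ x / 2 < (p : ℝ) ∧ (p : ℝ) ≤ x := by
  rw [windowPrimes, mem_filter, Nat.mem_primesLE]
  constructor
  · rintro ⟨⟨hp, hpr⟩, hx⟩
    refine ⟨hpr, hx, ?_⟩
    rcases lt_or_ge x 0 with h | h
    · rw [Nat.floor_of_nonpos h.le] at hp
      exact absurd (Nat.le_zero.1 hp) hpr.ne_zero
    · exact le_trans (Nat.cast_le.2 hp) (Nat.floor_le h)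
  · rintro ⟨hpr, hx, hle⟩
    exact ⟨⟨Nat.le_floor hle, hpr⟩, hx⟩

/-- At `x = 2X`, `X ∈ ℕ`, the window `(x/2, x]` is `(X, 2X]`: `windowPrimes (2X)` is the set of
primes of `Finset.Ioc X (2 * X)` (the indexing used by dyadic statements over `ℕ`). [folklore] -/
theorem windowPrimes_two_mul_natCast (X : ℕ) :
    windowPrimes (2 * (X : ℝ)) = (Ioc X (2 * X)).filter Nat.Prime := by
  ext p
  rw [mem_windowPrimes, mem_filter, mem_Ioc]
  have h2 : (2 * (X : ℝ)) / 2 = X := by ring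
  rw [h2]
  constructor
  · rintro ⟨hp, h₁, h₂⟩
    exact ⟨⟨by exact_mod_cast h₁, by exact_mod_cast h₂⟩, hp⟩
  · rintro ⟨⟨h₁, h₂⟩, hp⟩
    exact ⟨hp, by exact_mod_cast h₁, by exact_mod_cast h₂⟩

/-- First half of Ford–Maynard's growth condition (w) for a sequence `w` supported on `(x/2, x]`:
`∑_{x/2 < n ≤ x} |w_n| τ(n) ≤ x (log x)^ϖ`. (The second half, `w_n ≥ −x^{ν/10}`, is automatic for
`w = a − 1` with `a ≥ 0` and `x ≥ 1`, the only case transcribed here.)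
[cite: FordMaynard2024PrimeSieves, §2 (w)] -/
def GrowthBound (w : ℕ → ℝ) (x ϖ : ℝ) : Prop :=
  ∑ n ∈ (Icc 1 ⌊x⌋₊).filter (fun n : ℕ => x / 2 < (n : ℝ)), |w n| * (n.divisors.card : ℝ)
    ≤ x * Real.log x ^ ϖ

/-- First half of Ford–Maynard's condition (4.3) defining the divisor-bounded class:
`|w_n| ≤ τ(n)^ϱ` for `x/2 < n ≤ x` (`τ(n)^ϱ` a real power). (The second half,
`∑_p b_p ≥ x/(ϱ log x)`, concerns the comparison sequence; for `b = 1` it holds for `ϱ ≥ 3` and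
large `x`.) [cite: FordMaynard2024PrimeSieves, §4.3 (4.3)] -/
def DivisorBounded (w : ℕ → ℝ) (x ϱ : ℝ) : Prop :=
  ∀ n : ℕ, x / 2 < (n : ℝ) → (n : ℝ) ≤ x → |w n| ≤ (n.divisors.card : ℝ) ^ ϱ

/-- **`c` is an admissible lower-bound sieve constant at `(γ, θ, ν)`** for the comparison sequence
`b_n = 1` — Definition 4.8 of `C⁻(γ, θ, ν)` unfolded on the pairs `(a, 1)`: for every `ϖ > 1` there
are `B > 0` and `x₀` such that for all `x ≥ x₀`, every non-negative sequence `a` whose `w = a − 1`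
satisfies (w) with exponent `ϖ`, the Type-I bound (I) at level `x^γ` and the Type-II bound (II) on
`((x/2)^θ, x^{θ+ν}]` with exponent `B` has `∑_{x/2 < p ≤ x} a_p ≥ c · #{p : x/2 < p ≤ x}`. Thus
`C⁻(γ, θ, ν) > 0` implies `IsLowerSieveConst γ θ ν c` for some `c > 0` (module docstring).
[cite: FordMaynard2024PrimeSieves, Definitions 4.7–4.8] -/
def IsLowerSieveConst (γ θ ν c : ℝ) : Prop :=
  ∀ ϖ : ℝ, 1 < ϖ → ∃ B x₀ : ℝ, 0 < B ∧ ∀ x : ℝ, x₀ ≤ x → ∀ a : ℕ → ℝ, (∀ n, 0 ≤ a n) →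
    GrowthBound (fun n => a n - 1) x ϖ →
    FordMaynard.TypeI (fun n => a n - 1) x γ B → FordMaynard.TypeII (fun n => a n - 1) x θ ν B →
      c * ((windowPrimes x).card : ℝ) ≤ ∑ p ∈ windowPrimes x, a p

/-- **`c` is an admissible lower-bound sieve constant at `(γ, θ, ν)` for the divisor-bounded class
with exponent `ϱ`**, comparison sequence `b_n = 1` — Definition 4.9 of `ℬ⁻(γ, θ, ν; ϱ)` unfolded on
the pairs `(a, 1)`, with (w) and `ϖ` eliminated (under (4.3) they are implied for `ϖ` large in terms
of `ϱ`, §2.3): there are `B > 0` and `x₀` such that for all `x ≥ x₀`, every non-negative sequence `a`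
with `|a_n − 1| ≤ τ(n)^ϱ` on `(x/2, x]` whose `w = a − 1` satisfies (I) at level `x^γ` and (II) on
`((x/2)^θ, x^{θ+ν}]` with exponent `B` has `∑_{x/2 < p ≤ x} a_p ≥ c · #{p : x/2 < p ≤ x}`. Thus
`ℬ⁻(γ, θ, ν; ϱ') > c > 0` for `ϱ' = max(ϱ, 3)` implies `IsLowerSieveConstBdd γ θ ν ϱ c`.
[cite: FordMaynard2024PrimeSieves, Definition 4.9 and §2.3] -/
def IsLowerSieveConstBdd (γ θ ν ϱ c : ℝ) : Prop :=
  ∃ B x₀ : ℝ, 0 < B ∧ ∀ x : ℝ, x₀ ≤ x → ∀ a : ℕ → ℝ, (∀ n, 0 ≤ a n) →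
    DivisorBounded (fun n => a n - 1) x ϱ →
    FordMaynard.TypeI (fun n => a n - 1) x γ B → FordMaynard.TypeII (fun n => a n - 1) x θ ν B →
      c * ((windowPrimes x).card : ℝ) ≤ ∑ p ∈ windowPrimes x, a p

/-! ### The named fact -/

/-- **Ford–Maynard, Theorem 2.7 (b)** (arXiv:2407.14368, §2.4; proof §8, pp. 47–48). Fix `ϱ ≥ 1`.
For `ν ≥ 0.1663` (in the family `γ = 1/2`, `θ = 0`, `0 ≤ ν < 1/3`):
`C⁻(1/2, 0, ν) > 0` and `lim_{ε→0⁺} ℬ⁻(1/2 − ε, ε, ν − 2ε; ϱ) > 0` — Type-I information of level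
`x^{1/2}` together with Type-II information for `m ∈ (1, x^ν]` forces a positive proportion of the
expected number of primes, and so does, for divisor-bounded sequences, the `ε`-weakened information
(level `x^{1/2−ε}`, Type-II range `((x/2)^ε, x^{ν−ε}]`) in which such estimates are proved in practice,
uniformly in small `ε`. Transcribed for the comparison sequence `b_n = 1` on `(x/2, x]` through
`IsLowerSieveConst` / `IsLowerSieveConstBdd` (see their docstrings and the module docstring for the
unfolding of Definitions 4.8–4.9, Lemma 4.6 and the remark of §2.3 on (w)); the positive limit of the
monotone function `ε ↦ ℬ⁻(P_ε; ϱ)` is read as "one `c > 0` admissible for all small `ε`". The proof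
gives the explicit admissible value `C = 1 + I₃ + I₄ + I₅ + I₅' + I₆ ≥ 0.000006` at `ν = 0.16623`
(three of the integrals evaluated numerically with Mathematica — see the module docstring), and
`ν ≥ 0.16623` follows by monotonicity (Proposition 4.10); by Theorem 2.7 (c), `C⁻ = ℬ⁻ = 0` at
`ν = 0.1616`. Extensions to `ν ≤ 1` and to all real `ϱ` are the proved corollaries
`FordMaynard2024_thm27b.lowerSieveConst`, `FordMaynard2024_thm27b.lowerSieveConstBdd`.
[cite: FordMaynard2024PrimeSieves, Theorem 2.7 (b)]
[cite: FordMaynard2024PrimeSieves, Definitions 4.8–4.9, Lemma 4.6, Proposition 4.10] -/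
def FordMaynard2024_thm27b : Prop :=
  (∀ ν : ℝ, 0.1663 ≤ ν → ν < 1 / 3 → ∃ c : ℝ, 0 < c ∧ IsLowerSieveConst (1 / 2) 0 ν c) ∧
  (∀ ϱ ν : ℝ, 1 ≤ ϱ → 0.1663 ≤ ν → ν < 1 / 3 →
    ∃ ε₀ c : ℝ, 0 < ε₀ ∧ 0 < c ∧ ∀ ε : ℝ, 0 < ε → ε ≤ ε₀ →
      IsLowerSieveConstBdd (1 / 2 - ε) ε (ν - 2 * ε) ϱ c)

/-! ### Monotonicity of the hypotheses (Proposition 4.10 for these transcriptions) -/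

/-- (II) on a wider window implies (II) on a narrower one with the same left end-point (`x ≥ 1`):
extend the coefficients `ξ_m` by zero. [cite: FordMaynard2024PrimeSieves, Proposition 4.10] -/
theorem TypeII.mono_width {w : ℕ → ℝ} {x θ ν ν' B : ℝ} (hx : 1 ≤ x) (hν : ν' ≤ ν)
    (h : FordMaynard.TypeII w x θ ν B) : FordMaynard.TypeII w x θ ν' B := by
  classical
  intro ξ κ hξ hκ
  -- extend `ξ` by zero beyond `⌊x^(θ+ν')⌋₊`
  set ξ' : ℕ → ℂ := fun m => if m ≤ ⌊x ^ (θ + ν')⌋₊ then ξ m else 0 with hξ'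
  have hξ'b : ∀ m, ‖ξ' m‖ ≤ (m.divisors.card : ℝ) ^ B := by
    intro m
    simp only [hξ']
    split_ifs
    · exact hξ m
    · rw [norm_zero]; exact Real.rpow_nonneg (Nat.cast_nonneg _) _
  have key := h ξ' κ hξ'b hκ
  have hsub : (Icc 1 ⌊x ^ (θ + ν')⌋₊).filter (fun m : ℕ => (x / 2) ^ θ < (m : ℝ)) ⊆
      (Icc 1 ⌊x ^ (θ + ν)⌋₊).filter (fun m : ℕ => (x / 2) ^ θ < (m : ℝ)) := by
    apply Finset.filter_subset_filter
    apply Finset.Icc_subset_Icc_right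
    exact Nat.floor_le_floor (Real.rpow_le_rpow_of_exponent_le hx (by linarith))
  have heq : ∑ m ∈ (Icc 1 ⌊x ^ (θ + ν)⌋₊).filter (fun m : ℕ => (x / 2) ^ θ < (m : ℝ)),
        ∑ n ∈ (Icc 1 ⌊x⌋₊).filter (fun n : ℕ => x / 2 < (m * n : ℝ) ∧ (m * n : ℝ) ≤ x),
          ξ' m * κ n * (w (m * n) : ℂ)
      = ∑ m ∈ (Icc 1 ⌊x ^ (θ + ν')⌋₊).filter (fun m : ℕ => (x / 2) ^ θ < (m : ℝ)),
        ∑ n ∈ (Icc 1 ⌊x⌋₊).filter (fun n : ℕ => x / 2 < (m * n : ℝ) ∧ (m * n : ℝ) ≤ x),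
          ξ m * κ n * (w (m * n) : ℂ) := by
    rw [← Finset.sum_subset hsub]
    · refine Finset.sum_congr rfl fun m hm => ?_
      have hm' : m ≤ ⌊x ^ (θ + ν')⌋₊ := (Finset.mem_Icc.1 (Finset.mem_filter.1 hm).1).2
      simp only [hξ', if_pos hm']
    · intro m hmbig hmsmall
      have hm' : ¬ m ≤ ⌊x ^ (θ + ν')⌋₊ := by
        intro hle
        apply hmsmall
        rw [Finset.mem_filter, Finset.mem_Icc] at hmbig ⊢
        exact ⟨⟨hmbig.1.1, hle⟩, hmbig.2⟩
      simp [hξ', hm']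
  rw [heq] at key
  exact key

/-- The divisor bound `|w_n| ≤ τ(n)^ϱ` on `(x/2, x]` for an exponent `ϱ'` implies it for every
`ϱ ≥ ϱ'` (as `τ(n) ≥ 1`). [cite: FordMaynard2024PrimeSieves, §4.3 (4.3)] -/
theorem DivisorBounded.mono {w : ℕ → ℝ} {x ϱ ϱ' : ℝ} (hϱ : ϱ' ≤ ϱ)
    (h : DivisorBounded w x ϱ') : DivisorBounded w x ϱ := by
  intro n hn₁ hn₂
  refine le_trans (h n hn₁ hn₂) (Real.rpow_le_rpow_of_exponent_le ?_ hϱ)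
  have hn0 : n ≠ 0 := by
    rintro rfl
    simp only [Nat.cast_zero] at hn₁ hn₂
    linarith
  exact_mod_cast Finset.card_pos.2 ⟨1, Nat.one_mem_divisors.2 hn0⟩

/-- An admissible constant for the divisor-bounded class with exponent `ϱ` is admissible for every
smaller exponent and every wider Type-II window (Proposition 4.10 for `ℬ⁻`, transcribed).
[cite: FordMaynard2024PrimeSieves, Proposition 4.10] -/
theorem IsLowerSieveConstBdd.mono {γ θ ν ν' ϱ ϱ' c : ℝ} (hν : ν' ≤ ν) (hϱ : ϱ ≤ ϱ')
    (h : IsLowerSieveConstBdd γ θ ν' ϱ' c) : IsLowerSieveConstBdd γ θ ν ϱ c := by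
  obtain ⟨B, x₀, hB, H⟩ := h
  refine ⟨B, max x₀ 1, hB, fun x hx a ha hdiv hI hII => ?_⟩
  exact H x (le_trans (le_max_left _ _) hx) a ha (hdiv.mono hϱ) hI
    (TypeII.mono_width (le_trans (le_max_right _ _) hx) hν hII)

/-- An admissible constant is admissible for every wider Type-II window (Proposition 4.10 for `C⁻`,
transcribed). [cite: FordMaynard2024PrimeSieves, Proposition 4.10] -/
theorem IsLowerSieveConst.mono {γ θ ν ν' c : ℝ} (hν : ν' ≤ ν) (h : IsLowerSieveConst γ θ ν' c) :
    IsLowerSieveConst γ θ ν c := by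
  intro ϖ hϖ
  obtain ⟨B, x₀, hB, H⟩ := h ϖ hϖ
  refine ⟨B, max x₀ 1, hB, fun x hx a ha hw hI hII => ?_⟩
  exact H x (le_trans (le_max_left _ _) hx) a ha hw hI
    (TypeII.mono_width (le_trans (le_max_right _ _) hx) hν hII)

/-! ### Proved corollaries of the fact -/

/-- **Theorem 2.7 (b), first clause, for every `ν ∈ [0.1663, 1]`**: some `c > 0` is an admissible
lower-bound sieve constant at `(1/2, 0, ν)` (from the fact at `min ν (1/5)` by monotonicity in the
Type-II window). [cite: FordMaynard2024PrimeSieves, Theorem 2.7 (b) and Proposition 4.10] -/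
theorem FordMaynard2024_thm27b.lowerSieveConst (h : FordMaynard2024_thm27b) {ν : ℝ}
    (hν : 0.1663 ≤ ν) : ∃ c : ℝ, 0 < c ∧ IsLowerSieveConst (1 / 2) 0 ν c := by
  obtain ⟨c, hc, H⟩ := h.1 (min ν (1 / 5)) (le_min hν (by norm_num))
    (lt_of_le_of_lt (min_le_right _ _) (by norm_num))
  exact ⟨c, hc, H.mono (min_le_left _ _)⟩

/-- **Theorem 2.7 (b), second clause, for every `ν ≥ 0.1663` and every real `ϱ`**: there are
`ε₀ > 0` and `c > 0` such that for every `0 < ε ≤ ε₀`, `c` is an admissible lower-bound sieve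
constant at `(1/2 − ε, ε, ν − 2ε)` for the divisor-bounded class with exponent `ϱ` (from the fact at
`max ϱ 1` and `min ν (1/5)` by monotonicity). In particular (`ϱ = 0`): for all hosts `0 ≤ a_n ≤ 2`.
[cite: FordMaynard2024PrimeSieves, Theorem 2.7 (b) and Proposition 4.10] -/
theorem FordMaynard2024_thm27b.lowerSieveConstBdd (h : FordMaynard2024_thm27b) (ϱ : ℝ) {ν : ℝ}
    (hν : 0.1663 ≤ ν) :
    ∃ ε₀ c : ℝ, 0 < ε₀ ∧ 0 < c ∧ ∀ ε : ℝ, 0 < ε → ε ≤ ε₀ →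
      IsLowerSieveConstBdd (1 / 2 - ε) ε (ν - 2 * ε) ϱ c := by
  obtain ⟨ε₀, c, hε₀, hc, H⟩ := h.2 (max ϱ 1) (min ν (1 / 5)) (le_max_right _ _)
    (le_min hν (by norm_num)) (lt_of_le_of_lt (min_le_right _ _) (by norm_num))
  refine ⟨ε₀, c, hε₀, hc, fun ε hε hεε₀ => ?_⟩
  exact (H ε hε hεε₀).mono (by linarith [min_le_left ν (1 / 5)]) (le_max_left _ _)

/-- **The bounded-host form** used by sieve applications (e.g. hosts `a_n = 1 − λ(n + 2)`): for
`ν ≥ 0.1663` there are `ε₀ > 0` and `c > 0` such that for every `0 < ε ≤ ε₀` there are `B > 0`, `x₀`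
with: for all `x ≥ x₀` and every sequence `0 ≤ a_n ≤ 2`, the Type-I bound for `a − 1` at level
`x^{1/2−ε}` and the Type-II bound for `a − 1` on `((x/2)^ε, x^{ν−ε}]` (exponent `B`) give
`∑_{x/2 < p ≤ x} a_p ≥ c · #{p : x/2 < p ≤ x}` (the case `ϱ = 0` of `lowerSieveConstBdd`).
[cite: FordMaynard2024PrimeSieves, Theorem 2.7 (b)] -/
theorem FordMaynard2024_thm27b.boundedHost (h : FordMaynard2024_thm27b) {ν : ℝ} (hν : 0.1663 ≤ ν) :
    ∃ ε₀ c : ℝ, 0 < ε₀ ∧ 0 < c ∧ ∀ ε : ℝ, 0 < ε → ε ≤ ε₀ →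
      ∃ B x₀ : ℝ, 0 < B ∧ ∀ x : ℝ, x₀ ≤ x → ∀ a : ℕ → ℝ, (∀ n, 0 ≤ a n ∧ a n ≤ 2) →
        FordMaynard.TypeI (fun n => a n - 1) x (1 / 2 - ε) B →
        FordMaynard.TypeII (fun n => a n - 1) x ε (ν - 2 * ε) B →
          c * ((windowPrimes x).card : ℝ) ≤ ∑ p ∈ windowPrimes x, a p := by
  obtain ⟨ε₀, c, hε₀, hc, H⟩ := h.lowerSieveConstBdd 0 hν
  refine ⟨ε₀, c, hε₀, hc, fun ε hε hεε₀ => ?_⟩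
  obtain ⟨B, x₀, hB, H'⟩ := H ε hε hεε₀
  refine ⟨B, x₀, hB, fun x hx a ha hI hII => H' x hx a (fun n => (ha n).1) ?_ hI hII⟩
  intro n _ _
  rw [Real.rpow_zero, abs_le]
  constructor <;> linarith [(ha n).1, (ha n).2]

end Literature.NumberTheory.Sieve.FordMaynard
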